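import Summits.NavierStokesRegularity.FunctionalMining.TopEigColumnCharge
import HarnessLib

/-!
# FunctionalMining — brick N14b for EVERY real `q ≥ 1`: the heat-price density of `Φ_q` charges the
# `e₁`-column of `∇S` with constant `q · min (q − 1) (2/3)` (the variant below `q = 5/3`)

Search for candidate a priori estimates; no regularity claim. Cell `pub-nsfunc`, prove seat
(gen 29). `TopEigColumnCharge.lean` proves the no-go seat's brick N14b (SIEVELD §3.4b (4)) at every
point of the simple set `U_s = {λ₂ < λ₁}` with the constant `2q/3`, under `q ≥ 5/3` (the step
`q − 1 ≥ 2/3`). THIS FILE removes that restriction: the same two-channel argument gives, for every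
real `q ≥ 1`,

* **`channelIntegrand_ge_column_sq_min`** — at every `x ∈ U_s` (smooth divergence-free `v`):
  `q · min(q−1, 2/3) · λ₁^{q−2} ∑ₖ |S(∂ₖv)(x) u₀|² ≤ q(q−1)λ₁^{q−2}∑ₖ(∂ₖλ₁)² + qλ₁^{q−1}(Δλ₁ − μ(S;ΔS))`
  (the `a₀`-channel carries the factor `q(q−1)`, the transverse channels the factor `2q/3` from
  `0 < λ₁ − κ_a ≤ 3λ₁`; both are `≥ q·min(q−1, 2/3)`);
* **`channelIntegrand_ge_column_sq_of_le`** — for `1 ≤ q ≤ 5/3` the constant is `q(q−1)`;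
* **`heatDissipation_topEigMoment_ge_integral_column_min`** / **`_of_le`** — the integrated forms on
  fields with `λ₂ < λ₁` everywhere: `q·min(q−1,2/3) ∫ λ₁^{q−2}·topColumnSq ≤ T_q(v)`, resp. with
  `q(q−1)` for `1 ≤ q ≤ 5/3`.

This is the one-lemma variant recorded as missing in the prove seat's DERIVATIVES §51.3 (the (LL)
programme below `q = 2`: with it the amplitude-floor node of `TopEigGapCoerciveFloor` extends from
`5/3 ≤ q ≤ 2` to the whole brick range `6/5 ≤ q ≤ 2`, rate `∝ (q−1)κ^{2−q}` — NOT done here). Nothing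
is claimed about Proposition L-λ(η) itself, about constants, or about Navier–Stokes regularity. [ours]
-/

noncomputable section

open Filter Topology Matrix Finset MeasureTheory

namespace Summit.NavierStokesRegularity.FunctionalMining

open Literature.Analysis Literature.Analysis.FunctionSpaces Literature.Analysis.FunctionSpaces.Torus
  Literature.Analysis.Matrix

namespace TopEig

variable {v : UnitAddTorus (Fin 3) → EuclideanSpace ℝ (Fin 3)}

/-! ## 1. The column charge at a simple point, every real `q ≥ 1` -/

/-- **N14b, POINTWISE, for every real `q ≥ 1`.** Let `v` be smooth and divergence free on `T³`,
`x ∈ U_s` (`λ₂(x) < λ₁(x)`), `a₀` a basis index with `κ_{a₀} = λ₁(x)` and `u₀ := u_{a₀}`. Then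
`q·min(q−1, 2/3)·λ₁^{q−2}·∑ₖ |S(∂ₖv)(x)u₀|² ≤ q(q−1)λ₁^{q−2}∑ₖ(∂ₖλ₁)² + qλ₁^{q−1}(Δλ₁ − μ(S;ΔS))`.
Proof: `∂ₖλ₁ = u₀ᵀSₖu₀`, `Δλ₁ − μ = 2∑ₖ∑_{a≠a₀}(u_aᵀSₖu₀)²/(λ₁−κ_a)` with `0 < λ₁−κ_a ≤ 3λ₁`, so the
density is `≥ qλ₁^{q−2}[(q−1)∑ₖ(u₀ᵀSₖu₀)² + (2/3)∑ₖ∑_{a≠a₀}(u_aᵀSₖu₀)²]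
≥ q·min(q−1,2/3)·λ₁^{q−2}∑ₖ∑_a(u_aᵀSₖu₀)²`, and Parseval. [ours; the no-go seat's N14b
(SIEVELD §3.4b) at a point, constant made uniform in `q`] -/
theorem channelIntegrand_ge_column_sq_min {q : ℝ} (hq : 1 ≤ q) (hv : Torus.IsSmooth v)
    (hdiv : Torus.IsDivFree v) {x : UnitAddTorus (Fin 3)}
    (hx : torusStrainMidEig v x < torusStrainTopEig v x) {a₀ : Fin 3}
    (ha₀ : (torusStrainMatrix_isHermitian v x).eigenvalues a₀ = torusStrainTopEig v x) :
    q * min (q - 1) (2 / 3) * torusStrainTopEig v x ^ (q - 2) *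
        ∑ k, (torusStrainMatrix (Torus.partialDeriv k v) x *ᵥ
              ((torusStrainMatrix_isHermitian v x).eigenvectorBasis a₀).ofLp) ⬝ᵥ
            (torusStrainMatrix (Torus.partialDeriv k v) x *ᵥ
              ((torusStrainMatrix_isHermitian v x).eigenvectorBasis a₀).ofLp) ≤
      q * (q - 1) * torusStrainTopEig v x ^ (q - 2) *
          ∑ k, Torus.partialDeriv k (torusStrainTopEig v) x ^ 2 +
        q * torusStrainTopEig v x ^ (q - 1) * (Torus.laplacian (torusStrainTopEig v) x -
          dirTopEig (StrainL4.strainFlat v x) (StrainL4.strainFlat (Torus.laplacian v) x)) := by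
  set hS := torusStrainMatrix_isHermitian v x with hSdef
  set lam : ℝ := torusStrainTopEig v x with hlam
  set u : Fin 3 → Fin 3 → ℝ := fun a => (hS.eigenvectorBasis a).ofLp with hu
  set Sk : Fin 3 → Matrix (Fin 3) (Fin 3) ℝ := fun k => torusStrainMatrix (Torus.partialDeriv k v) x
    with hSk
  set m : ℝ := min (q - 1) (2 / 3) with hm
  -- gap form at `u a₀`, positivity of `λ₁`
  obtain ⟨he1, hSe, hgap⟩ := gapForm_eigenvectorBasis hx ha₀
  have hg : 0 < torusStrainTopEig v x - torusStrainMidEig v x := sub_pos.2 hx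
  have hlam0 : 0 < lam := (lam_pos_of_gapForm_of_isDivFree hv hdiv he1 hSe hg hgap).2
  -- Hellmann–Feynman and the R-form
  have hHF : ∀ k, Torus.partialDeriv k (torusStrainTopEig v) x = u a₀ ⬝ᵥ (Sk k *ᵥ u a₀) := fun k =>
    (partialDeriv_partialDeriv_torusStrainTopEig_eq_sum_frame hv hx ha₀ k).1
  have hR := laplacian_torusStrainTopEig_eq_sum_frame hv hx ha₀
  have hμ : dirTopEig (StrainL4.strainFlat v x) (StrainL4.strainFlat (Torus.laplacian v) x) =
      u a₀ ⬝ᵥ (torusStrainMatrix (Torus.laplacian v) x *ᵥ u a₀) :=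
    dirTopEig_strainFlat_eq_of_gapForm he1 hSe hg hgap (Torus.laplacian v)
  -- `Δλ₁ − μ = 2 ∑ₖ ∑_{a ≠ a₀} (u_aᵀ Sₖ u₀)² / (λ₁ − κ_a)`
  have hdiff : Torus.laplacian (torusStrainTopEig v) x -
      dirTopEig (StrainL4.strainFlat v x) (StrainL4.strainFlat (Torus.laplacian v) x) =
      2 * ∑ k, ∑ a ∈ Finset.univ.erase a₀,
        (u a ⬝ᵥ (Sk k *ᵥ u a₀)) ^ 2 / (lam - hS.eigenvalues a) := by
    rw [hμ, hR]; ring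
  -- each channel with `a ≠ a₀`: `(…)²/(λ₁−κ_a) ≥ (…)²/(3λ₁)`
  have hchan : ∀ k, ∀ a ∈ Finset.univ.erase a₀,
      (u a ⬝ᵥ (Sk k *ᵥ u a₀)) ^ 2 / (3 * lam) ≤
        (u a ⬝ᵥ (Sk k *ᵥ u a₀)) ^ 2 / (lam - hS.eigenvalues a) := by
    intro k a ha
    have ha' : a ≠ a₀ := Finset.ne_of_mem_erase ha
    obtain ⟨hpos, hle⟩ := topEig_sub_eigenvalues_pos_le hv hdiv hx ha₀ ha'
    exact div_le_div_of_nonneg_left (sq_nonneg _) hpos hle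
  -- Parseval: `|Sₖu₀|² = (u₀ᵀSₖu₀)² + ∑_{a≠a₀}(u_aᵀSₖu₀)²`
  have hpars : ∀ k, (Sk k *ᵥ u a₀) ⬝ᵥ (Sk k *ᵥ u a₀) =
      (u a₀ ⬝ᵥ (Sk k *ᵥ u a₀)) ^ 2 + ∑ a ∈ Finset.univ.erase a₀, (u a ⬝ᵥ (Sk k *ᵥ u a₀)) ^ 2 := by
    intro k
    rw [← sum_sq_frame_eq_column_sq x (Sk k) (u a₀),
      ← Finset.add_sum_erase Finset.univ _ (Finset.mem_univ a₀)]
  have hq0 : 0 < q := by linarith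
  have hm1 : m ≤ q - 1 := min_le_left _ _
  have hm2 : m ≤ 2 / 3 := min_le_right _ _
  have hm0 : 0 ≤ m := le_min (by linarith) (by norm_num)
  have hp2 : 0 ≤ lam ^ (q - 2) := Real.rpow_nonneg hlam0.le _
  have hp1 : lam ^ (q - 1) = lam ^ (q - 2) * lam := by
    rw [show q - 1 = (q - 2) + 1 by ring, Real.rpow_add hlam0, Real.rpow_one]
  -- lower bound of the channel part
  have hA : ∀ k, 2 / (3 * lam) * ∑ a ∈ Finset.univ.erase a₀, (u a ⬝ᵥ (Sk k *ᵥ u a₀)) ^ 2 ≤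
      2 * ∑ a ∈ Finset.univ.erase a₀, (u a ⬝ᵥ (Sk k *ᵥ u a₀)) ^ 2 / (lam - hS.eigenvalues a) := by
    intro k
    rw [Finset.mul_sum, Finset.mul_sum]
    refine Finset.sum_le_sum fun a ha => ?_
    have h := hchan k a ha
    have e : 2 / (3 * lam) * (u a ⬝ᵥ (Sk k *ᵥ u a₀)) ^ 2 =
        2 * ((u a ⬝ᵥ (Sk k *ᵥ u a₀)) ^ 2 / (3 * lam)) := by
      ring
    rw [e]; linarith
  -- the main chain, with `A := ∑ₖ(u₀ᵀSₖu₀)²`, `B := ∑ₖ∑_{a≠a₀}(u_aᵀSₖu₀)²`, `Bw :=` the weighted sum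
  set A : ℝ := ∑ k, (u a₀ ⬝ᵥ (Sk k *ᵥ u a₀)) ^ 2 with hAdef
  set B : ℝ := ∑ k, ∑ a ∈ Finset.univ.erase a₀, (u a ⬝ᵥ (Sk k *ᵥ u a₀)) ^ 2 with hBdef
  set Bw : ℝ := ∑ k, ∑ a ∈ Finset.univ.erase a₀,
    (u a ⬝ᵥ (Sk k *ᵥ u a₀)) ^ 2 / (lam - hS.eigenvalues a) with hBwdef
  have hA0 : 0 ≤ A := Finset.sum_nonneg fun k _ => sq_nonneg _
  have hB0 : 0 ≤ B := Finset.sum_nonneg fun k _ => Finset.sum_nonneg fun a _ => sq_nonneg _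
  have hcol : ∑ k, (Sk k *ᵥ u a₀) ⬝ᵥ (Sk k *ᵥ u a₀) = A + B := by
    rw [hAdef, hBdef, ← Finset.sum_add_distrib]
    exact Finset.sum_congr rfl fun k _ => hpars k
  have hBle : 2 / (3 * lam) * B ≤ 2 * Bw := by
    rw [hBdef, hBwdef, Finset.mul_sum, Finset.mul_sum]
    exact Finset.sum_le_sum fun k _ => hA k
  -- the density in terms of `A` and `Bw`
  have hdens : q * (q - 1) * torusStrainTopEig v x ^ (q - 2) *
          ∑ k, Torus.partialDeriv k (torusStrainTopEig v) x ^ 2 +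
        q * torusStrainTopEig v x ^ (q - 1) * (Torus.laplacian (torusStrainTopEig v) x -
          dirTopEig (StrainL4.strainFlat v x) (StrainL4.strainFlat (Torus.laplacian v) x)) =
      q * (q - 1) * lam ^ (q - 2) * A + q * lam ^ (q - 1) * (2 * Bw) := by
    rw [hdiff]
    simp_rw [hHF]
    rfl
  rw [hdens, hcol]
  -- the two halves: `a₀`-channel with `m ≤ q − 1`, transverse channels with `m ≤ 2/3`
  have h1 : q * m * lam ^ (q - 2) * A ≤ q * (q - 1) * lam ^ (q - 2) * A := by
    have e : q * (q - 1) * lam ^ (q - 2) * A - q * m * lam ^ (q - 2) * A =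
        q * lam ^ (q - 2) * A * ((q - 1) - m) := by ring
    have h13 : 0 ≤ (q - 1) - m := by linarith
    have : 0 ≤ q * lam ^ (q - 2) * A * ((q - 1) - m) :=
      mul_nonneg (mul_nonneg (mul_nonneg hq0.le hp2) hA0) h13
    linarith
  have h2' : 2 * q / 3 * lam ^ (q - 2) * B ≤ q * lam ^ (q - 1) * (2 * Bw) := by
    have hl : lam ≠ 0 := hlam0.ne'
    have e3 : lam * (2 / (3 * lam)) = 2 / 3 := by
      field_simp
    have e : 2 * q / 3 * lam ^ (q - 2) * B = q * lam ^ (q - 1) * (2 / (3 * lam) * B) := by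
      rw [hp1]
      calc 2 * q / 3 * lam ^ (q - 2) * B = q * lam ^ (q - 2) * (2 / 3) * B := by ring
        _ = q * lam ^ (q - 2) * (lam * (2 / (3 * lam))) * B := by rw [e3]
        _ = q * (lam ^ (q - 2) * lam) * (2 / (3 * lam) * B) := by ring
    rw [e]
    have hc : 0 ≤ q * lam ^ (q - 1) := mul_nonneg hq0.le (Real.rpow_nonneg hlam0.le _)
    exact mul_le_mul_of_nonneg_left hBle hc
  have h2 : q * m * lam ^ (q - 2) * B ≤ q * lam ^ (q - 1) * (2 * Bw) := by
    have e : 2 * q / 3 * lam ^ (q - 2) * B - q * m * lam ^ (q - 2) * B =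
        q * lam ^ (q - 2) * B * (2 / 3 - m) := by ring
    have h23 : 0 ≤ 2 / 3 - m := by linarith
    have : 0 ≤ q * lam ^ (q - 2) * B * (2 / 3 - m) :=
      mul_nonneg (mul_nonneg (mul_nonneg hq0.le hp2) hB0) h23
    linarith
  calc q * m * lam ^ (q - 2) * (A + B)
      = q * m * lam ^ (q - 2) * A + q * m * lam ^ (q - 2) * B := by ring
    _ ≤ q * (q - 1) * lam ^ (q - 2) * A + q * lam ^ (q - 1) * (2 * Bw) := add_le_add h1 h2

/-- **N14b, POINTWISE, for `1 ≤ q ≤ 5/3`: constant `q(q−1)`** (then `min(q−1, 2/3) = q − 1`).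
[ours, corollary of `channelIntegrand_ge_column_sq_min`] -/
theorem channelIntegrand_ge_column_sq_of_le {q : ℝ} (hq : 1 ≤ q) (hq' : q ≤ 5 / 3)
    (hv : Torus.IsSmooth v) (hdiv : Torus.IsDivFree v) {x : UnitAddTorus (Fin 3)}
    (hx : torusStrainMidEig v x < torusStrainTopEig v x) {a₀ : Fin 3}
    (ha₀ : (torusStrainMatrix_isHermitian v x).eigenvalues a₀ = torusStrainTopEig v x) :
    q * (q - 1) * torusStrainTopEig v x ^ (q - 2) *
        ∑ k, (torusStrainMatrix (Torus.partialDeriv k v) x *ᵥ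
              ((torusStrainMatrix_isHermitian v x).eigenvectorBasis a₀).ofLp) ⬝ᵥ
            (torusStrainMatrix (Torus.partialDeriv k v) x *ᵥ
              ((torusStrainMatrix_isHermitian v x).eigenvectorBasis a₀).ofLp) ≤
      q * (q - 1) * torusStrainTopEig v x ^ (q - 2) *
          ∑ k, Torus.partialDeriv k (torusStrainTopEig v) x ^ 2 +
        q * torusStrainTopEig v x ^ (q - 1) * (Torus.laplacian (torusStrainTopEig v) x -
          dirTopEig (StrainL4.strainFlat v x) (StrainL4.strainFlat (Torus.laplacian v) x)) := by
  have hmin : min (q - 1) (2 / 3) = q - 1 := min_eq_left (by linarith)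
  have h := channelIntegrand_ge_column_sq_min hq hv hdiv hx ha₀
  rw [hmin] at h
  exact h

/-! ## 2. Integrated forms on fields with `λ₂ < λ₁` everywhere -/

/-- **N14b, INTEGRATED, for every real `q ≥ 1`, on fields whose top strain eigenvalue is simple
everywhere:** for `v` smooth and divergence free on `T³` with `λ₂(x) < λ₁(x)` at every `x`,
`q·min(q−1, 2/3) ∫ λ₁^{q−2}·topColumnSq ≤ heatDissipation Φ_q v = T_q(v)` (Cor. 3′(a) identity
`heatDissipation_topEigMoment_eq_integral_of_midEig_lt` and `channelIntegrand_ge_column_sq_min`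
pointwise; the channel density is integrable as `Δ(λ₁^q) − qλ₁^{q−1}μ`). For `q ≥ 5/3` this is the
tree's `heatDissipation_topEigMoment_ge_integral_column` (constant `2q/3`). [ours] -/
theorem heatDissipation_topEigMoment_ge_integral_column_min {q : ℝ} (hq : 1 ≤ q)
    (hv : Torus.IsSmooth v) (hdiv : Torus.IsDivFree v)
    (hsimple : ∀ x : UnitAddTorus (Fin 3), torusStrainMidEig v x < torusStrainTopEig v x) :
    q * min (q - 1) (2 / 3) * ∫ x, torusStrainTopEig v x ^ (q - 2) * topColumnSq v x ≤
      heatDissipation (torusTopEigMoment q) v := by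
  obtain ⟨hid, -, -⟩ := heatDissipation_topEigMoment_eq_integral_of_midEig_lt hq hv hdiv hsimple
  rw [hid, ← integral_const_mul]
  -- gap form everywhere, smoothness and positivity of `λ₁`
  have hgf : ∀ x : UnitAddTorus (Fin 3), ∃ (e : Fin 3 → ℝ) (lam g : ℝ), e ⬝ᵥ e = 1 ∧
      torusStrainMatrix v x *ᵥ e = lam • e ∧ 0 < g ∧
      ∀ w, w ⬝ᵥ e = 0 → w ⬝ᵥ torusStrainMatrix v x *ᵥ w ≤ (lam - g) * (w ⬝ᵥ w) := fun x => by
    obtain ⟨e, he1, hSe, hg, hgap⟩ := exists_gapForm_of_midEig_lt_topEig (hsimple x)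
    exact ⟨e, _, _, he1, hSe, hg, hgap⟩
  have hls : Torus.IsSmooth (torusStrainTopEig v) := isSmooth_torusStrainTopEig_of_simple hv hgf
  have hpos : ∀ x, 0 < torusStrainTopEig v x := fun x => by
    obtain ⟨e, lam, g, he1, hSe, hg, hgap⟩ := hgf x
    rw [torusStrainTopEig_eq_of_gapForm he1 hSe hg hgap]
    exact (lam_pos_of_gapForm_of_isDivFree hv hdiv he1 hSe hg hgap).2
  -- integrability of the channel density: it is `Δ(λ₁^q) − qλ₁^{q−1}μ`
  have hlq : Torus.IsSmooth (fun y => torusStrainTopEig v y ^ q) := isSmooth_rpow_of_pos hls hpos q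
  have hD := integrable_danskinDensity hq hv hv.laplacian hdiv
  have hL := hlq.laplacian.integrable
  have hint : Integrable (fun x => q * (q - 1) * torusStrainTopEig v x ^ (q - 2) *
        ∑ k, Torus.partialDeriv k (torusStrainTopEig v) x ^ 2 +
      q * torusStrainTopEig v x ^ (q - 1) * (Torus.laplacian (torusStrainTopEig v) x -
        dirTopEig (StrainL4.strainFlat v x) (StrainL4.strainFlat (Torus.laplacian v) x))) volume := by
    refine (hL.sub hD).congr (ae_of_all _ fun x => ?_)
    simp only [Pi.sub_apply]
    rw [laplacian_rpow_of_pos hls hpos q x]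
    ring
  have hm0 : 0 ≤ q * min (q - 1) (2 / 3) :=
    mul_nonneg (by linarith) (le_min (by linarith) (by norm_num))
  refine integral_mono_of_nonneg (ae_of_all _ fun x => ?_) hint (ae_of_all _ fun x => ?_)
  · exact mul_nonneg hm0 (mul_nonneg (Real.rpow_nonneg (hpos x).le _) (topColumnSq_nonneg v x))
  · have h := channelIntegrand_ge_column_sq_min hq hv hdiv (hsimple x) (eigenvalues_topIndex v x)
    calc q * min (q - 1) (2 / 3) * (torusStrainTopEig v x ^ (q - 2) * topColumnSq v x)
        = q * min (q - 1) (2 / 3) * torusStrainTopEig v x ^ (q - 2) * topColumnSq v x := by ring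
      _ ≤ _ := h

/-- **N14b, INTEGRATED, for `1 ≤ q ≤ 5/3`: constant `q(q−1)`** — `q(q−1) ∫ λ₁^{q−2}·topColumnSq ≤ T_q(v)`
on smooth divergence-free fields with `λ₂ < λ₁` everywhere. [ours, corollary] -/
theorem heatDissipation_topEigMoment_ge_integral_column_of_le {q : ℝ} (hq : 1 ≤ q) (hq' : q ≤ 5 / 3)
    (hv : Torus.IsSmooth v) (hdiv : Torus.IsDivFree v)
    (hsimple : ∀ x : UnitAddTorus (Fin 3), torusStrainMidEig v x < torusStrainTopEig v x) :
    q * (q - 1) * ∫ x, torusStrainTopEig v x ^ (q - 2) * topColumnSq v x ≤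
      heatDissipation (torusTopEigMoment q) v := by
  have hmin : min (q - 1) (2 / 3) = q - 1 := min_eq_left (by linarith)
  have h := heatDissipation_topEigMoment_ge_integral_column_min hq hv hdiv hsimple
  rw [hmin] at h
  exact h

end TopEig

end Summit.NavierStokesRegularity.FunctionalMining

end
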